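import Mathlib
import HarnessLib
import Summits.ValiantsHypothesis.ValiantsHypothesis.Theorems.CirculantFourierRealFormsRealify
import Literature.Computability.AlgebraicComplexity.ArithCircuitProofs
import Summits.ValiantsHypothesis.ValiantsHypothesis.Theorems.CirculantFourierTargetImpliesSensitive

/-!
# Route MonotoneRestoration — kill witness `PolylogWidthMonotoneEasy`: real parts and the dense shift (helpers)

Support file for item `stmt-ValiantsHypothesis-17619` (`PolylogWidthMonotoneEasy`). Helper lemmas
for removing the NONNEGATIVITY of the coefficients from the nonnegative-VP form of the witness:
real and imaginary parts of complex polynomials (uniqueness, evaluation at real points, degree),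
the dense polynomial `(1 + Σ_p x_p)^D` over `ℝ` (all coefficients `≥ 0`, and `≥ 1` in degree
`≤ D`; cost `≤ D (N + 2)` on `N` variables), and the lift of a real polynomial with nonnegative
coefficients to `ℝ≥0`.

No new definitions.
-/

set_option linter.dupNamespace false

namespace Summit.ValiantsHypothesis.ValiantsHypothesis.Theorems

open MvPolynomial Literature.Computability.AlgebraicComplexity

/-! ### Real and imaginary parts -/

/-- Uniqueness of the decomposition `F = x + i y` of a complex polynomial into real polynomials
(compare coefficients). [folklore] -/
theorem realParts_unique {τ : Type*} {x y x' y' : MvPolynomial τ ℝ}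
    (h : map Complex.ofRealHom x + C Complex.I * map Complex.ofRealHom y =
      map Complex.ofRealHom x' + C Complex.I * map Complex.ofRealHom y') :
    x = x' ∧ y = y' := by
  have hc : ∀ m, ((coeff m x : ℝ) : ℂ) + Complex.I * ((coeff m y : ℝ) : ℂ) =
      ((coeff m x' : ℝ) : ℂ) + Complex.I * ((coeff m y' : ℝ) : ℂ) := by
    intro m
    have := congrArg (coeff m) h
    simpa [coeff_map, coeff_C_mul] using this
  constructor
  · ext m
    have := congrArg Complex.re (hc m)
    simpa using this
  · ext m
    have := congrArg Complex.im (hc m)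
    simpa using this

/-- Evaluation of `map ofReal x` at a real point is the real evaluation. [folklore] -/
theorem eval_ofReal_map {τ : Type*} (A : τ → ℝ) (x : MvPolynomial τ ℝ) :
    eval (fun t => (A t : ℂ)) (map Complex.ofRealHom x) = ((eval A x : ℝ) : ℂ) := by
  rw [eval_map]
  have h := (eval₂_comp_left Complex.ofRealHom (RingHom.id ℝ) A x)
  rw [Complex.ofRealHom.comp_id] at h
  rw [show (fun t => (A t : ℂ)) = Complex.ofRealHom ∘ A from rfl, ← h]
  rfl

/-- Evaluation of `x + i y` at a real point: `x(A) + i y(A)`. [folklore] -/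
theorem eval_ofReal_decomp {τ : Type*} (A : τ → ℝ) (x y : MvPolynomial τ ℝ) :
    eval (fun t => (A t : ℂ)) (map Complex.ofRealHom x + C Complex.I * map Complex.ofRealHom y) =
      ((eval A x : ℝ) : ℂ) + Complex.I * ((eval A y : ℝ) : ℂ) := by
  simp only [map_add, map_mul, eval_C, eval_ofReal_map]

/-- If `x + i y` takes different values at two real points then `x` or `y` does. [folklore] -/
theorem eval_ne_or_eval_ne_of_decomp {τ : Type*} (A B : τ → ℝ) (x y : MvPolynomial τ ℝ)
    (h : eval (fun t => (A t : ℂ)) (map Complex.ofRealHom x + C Complex.I * map Complex.ofRealHom y) ≠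
      eval (fun t => (B t : ℂ)) (map Complex.ofRealHom x + C Complex.I * map Complex.ofRealHom y)) :
    eval A x ≠ eval B x ∨ eval A y ≠ eval B y := by
  by_contra hcon
  push Not at hcon
  apply h
  rw [eval_ofReal_decomp, eval_ofReal_decomp, hcon.1, hcon.2]

/-- The support of the real part is contained in the support of `F = x + i y`; hence
`totalDegree x ≤ totalDegree F`, and likewise for `y`. [folklore] -/
theorem totalDegree_realParts_le {τ : Type*} (x y : MvPolynomial τ ℝ) :
    x.totalDegree ≤ (map Complex.ofRealHom x + C Complex.I * map Complex.ofRealHom y).totalDegree ∧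
    y.totalDegree ≤ (map Complex.ofRealHom x + C Complex.I * map Complex.ofRealHom y).totalDegree := by
  have hc : ∀ m, coeff m (map Complex.ofRealHom x + C Complex.I * map Complex.ofRealHom y) =
      ((coeff m x : ℝ) : ℂ) + Complex.I * ((coeff m y : ℝ) : ℂ) := by
    intro m
    simp [coeff_map, coeff_C_mul]
  constructor
  · refine Finset.sup_mono fun m hm => ?_
    rw [mem_support_iff] at hm ⊢
    rw [hc m]
    intro h0
    apply hm
    have := congrArg Complex.re h0
    simpa using this
  · refine Finset.sup_mono fun m hm => ?_
    rw [mem_support_iff] at hm ⊢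
    rw [hc m]
    intro h0
    apply hm
    have := congrArg Complex.im h0
    simpa using this

/-- Multiplying by `-i` swaps the parts: `-i (x + i y) = y + i (-x)`. [folklore] -/
theorem negI_mul_decomp {τ : Type*} (x y : MvPolynomial τ ℝ) :
    C (-Complex.I) * (map Complex.ofRealHom x + C Complex.I * map Complex.ofRealHom y) =
      map Complex.ofRealHom y + C Complex.I * map Complex.ofRealHom (-x) := by
  have h : (C Complex.I : MvPolynomial τ ℂ) * C Complex.I = -1 := RealForms.C_I_mul_C_I
  rw [show (C (-Complex.I) : MvPolynomial τ ℂ) = -C Complex.I from map_neg C Complex.I, map_neg]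
  linear_combination (-(map Complex.ofRealHom y)) * h

/-- Renaming commutes with the decomposition: if `F = x + i y` is invariant under a renaming then
so are `x` and `y`. [folklore] -/
theorem rename_realParts {τ : Type*} (e : τ → τ) {F : MvPolynomial τ ℂ} {x y : MvPolynomial τ ℝ}
    (hF : F = map Complex.ofRealHom x + C Complex.I * map Complex.ofRealHom y)
    (hinv : rename e F = F) : rename e x = x ∧ rename e y = y := by
  apply realParts_unique
  rw [← hF]
  conv_rhs => rw [← hinv, hF]
  simp only [map_add, map_mul, rename_C, map_rename]

/-! ### The dense polynomial `(1 + Σ_p x_p)^D` over `ℝ` -/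

/-- `(1 + Σ_p x_p)^D` over `ℝ` is the image of the same polynomial over `ℝ≥0`, so all its
coefficients are nonnegative. [folklore] -/
theorem coeff_densePow_nonneg {τ : Type*} [Fintype τ] (D : ℕ) (m : τ →₀ ℕ) :
    0 ≤ coeff m ((1 + ∑ p : τ, X p : MvPolynomial τ ℝ) ^ D) := by
  have h : ((1 + ∑ p : τ, X p : MvPolynomial τ ℝ) ^ D) =
      map NNReal.toRealHom ((1 + ∑ p : τ, X p : MvPolynomial τ NNReal) ^ D) := by
    simp only [map_pow, map_add, map_one, map_sum, map_X]
  rw [h, coeff_map]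
  exact NNReal.coe_nonneg _

/-- More generally every product `q · (1 + Σ_p x_p)^D` with `q` the image of an `ℝ≥0`-polynomial has
nonnegative coefficients; used with `q = x_p`. [folklore] -/
theorem coeff_X_mul_densePow_nonneg {τ : Type*} [Fintype τ] (D : ℕ) (p : τ) (m : τ →₀ ℕ) :
    0 ≤ coeff m ((X p : MvPolynomial τ ℝ) * (1 + ∑ p : τ, X p : MvPolynomial τ ℝ) ^ D) := by
  have h : ((X p : MvPolynomial τ ℝ) * (1 + ∑ p : τ, X p : MvPolynomial τ ℝ) ^ D) =
      map NNReal.toRealHom ((X p : MvPolynomial τ NNReal) * (1 + ∑ p : τ, X p) ^ D) := by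
    simp only [map_mul, map_pow, map_add, map_one, map_sum, map_X]
  rw [h, coeff_map]
  exact NNReal.coe_nonneg _

/-- **Every monomial of degree `≤ D` occurs in `(1 + Σ_p x_p)^D` with coefficient `≥ 1`**
(induction on `D`: `(1+S)^{D+1} = (1+S)^D + Σ_p x_p (1+S)^D`, all terms nonnegative, and a
monomial of degree `D + 1` is `x_p · m'` with `deg m' = D`). [folklore] -/
theorem one_le_coeff_densePow {τ : Type*} [Fintype τ] [DecidableEq τ] :
    ∀ (D : ℕ) (m : τ →₀ ℕ), m.degree ≤ D →
      1 ≤ coeff m ((1 + ∑ p : τ, X p : MvPolynomial τ ℝ) ^ D) := by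
  intro D
  induction D with
  | zero =>
    intro m hm
    have hm0 : m = 0 := (Finsupp.degree_eq_zero_iff m).1 (Nat.le_zero.1 hm)
    subst hm0
    simp
  | succ D ih =>
    intro m hm
    have hexp : ((1 + ∑ p : τ, X p : MvPolynomial τ ℝ) ^ (D + 1)) =
        (1 + ∑ p : τ, X p : MvPolynomial τ ℝ) ^ D +
          ∑ p : τ, (X p : MvPolynomial τ ℝ) * (1 + ∑ p : τ, X p : MvPolynomial τ ℝ) ^ D := by
      rw [pow_succ, mul_comm, add_mul, one_mul, Finset.sum_mul]
    rw [hexp, coeff_add, coeff_sum]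
    rcases Nat.lt_or_ge m.degree (D + 1) with hlt | hge
    · -- degree ≤ D: the first summand already gives 1
      have h1 := ih m (by omega)
      have h2 : 0 ≤ ∑ p : τ, coeff m ((X p : MvPolynomial τ ℝ) * (1 + ∑ p : τ, X p) ^ D) :=
        Finset.sum_nonneg fun p _ => coeff_X_mul_densePow_nonneg D p m
      linarith
    · -- degree = D + 1: pick a variable `p` of `m`, then `m = x_p · m'`
      have hdeg : m.degree = D + 1 := le_antisymm hm hge
      have hm0 : m ≠ 0 := by
        intro h0
        rw [h0, map_zero] at hdeg
        omega
      obtain ⟨p, hp⟩ := Finsupp.ne_iff.1 hm0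
      simp only [Finsupp.coe_zero, Pi.zero_apply] at hp
      have hps : p ∈ m.support := Finsupp.mem_support_iff.2 hp
      have h1 : 0 ≤ coeff m ((1 + ∑ p : τ, X p : MvPolynomial τ ℝ) ^ D) := coeff_densePow_nonneg D m
      have h3 : coeff m ((X p : MvPolynomial τ ℝ) * (1 + ∑ p : τ, X p) ^ D) =
          coeff (m - Finsupp.single p 1) ((1 + ∑ p : τ, X p : MvPolynomial τ ℝ) ^ D) := by
        rw [coeff_X_mul', if_pos hps]
      have h4 : (m - Finsupp.single p 1).degree ≤ D := by
        have hsum : m - Finsupp.single p 1 + Finsupp.single p 1 = m := by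
          ext q
          simp only [Finsupp.coe_add, Finsupp.coe_tsub, Pi.add_apply, Pi.sub_apply,
            Finsupp.single_apply]
          split_ifs with hq
          · subst hq; omega
          · omega
        have := congrArg Finsupp.degree hsum
        rw [map_add, Finsupp.degree_single, hdeg] at this
        omega
      have h5 := ih (m - Finsupp.single p 1) h4
      have h6 : coeff m ((X p : MvPolynomial τ ℝ) * (1 + ∑ p : τ, X p) ^ D) ≤
          ∑ p : τ, coeff m ((X p : MvPolynomial τ ℝ) * (1 + ∑ p : τ, X p) ^ D) :=
        Finset.single_le_sum (fun p' _ => coeff_X_mul_densePow_nonneg D p' m) (Finset.mem_univ p)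
      linarith

/-- Cost of the dense polynomial: `L((1 + Σ_p x_p)^D) ≤ D (N + 2)` on `N` variables. [folklore] -/
theorem complexity_densePow_le {k : Type*} [CommSemiring k] {τ : Type*} [Fintype τ] (D : ℕ) :
    complexity ((1 + ∑ p : τ, X p : MvPolynomial τ k) ^ D) ≤ D * (Fintype.card τ + 2) := by
  have h0 : complexity (∑ p : τ, (X p : MvPolynomial τ k)) ≤ Fintype.card τ := by
    have h := complexity_finset_sum_le (Finset.univ : Finset τ) (fun p => (X p : MvPolynomial τ k))
    rw [Finset.sum_eq_zero (fun i _ => complexity_X_holds (k := k) (σ := τ) i), zero_add,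
      Finset.card_univ] at h
    exact h
  have h1 : complexity (1 + ∑ p : τ, X p : MvPolynomial τ k) ≤ Fintype.card τ + 1 := by
    calc _ ≤ complexity (1 : MvPolynomial τ k) +
          complexity (∑ p : τ, (X p : MvPolynomial τ k)) + 1 := complexity_add_le_holds _ _
      _ ≤ 0 + Fintype.card τ + 1 := by
          gcongr
          rw [← C_1, complexity_C_holds]
      _ = Fintype.card τ + 1 := by ring
  calc _ ≤ D * (complexity (1 + ∑ p : τ, X p : MvPolynomial τ k) + 1) :=
        CirculantFourierTargetImpliesSensitive.complexity_pow_le _ _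
    _ ≤ D * (Fintype.card τ + 1 + 1) := by gcongr
    _ = D * (Fintype.card τ + 2) := by ring

/-- The dense polynomial is invariant under every renaming along a bijection of the variables.
[folklore] -/
theorem rename_densePow {k : Type*} [CommSemiring k] {τ : Type*} [Fintype τ] (e : τ ≃ τ) (D : ℕ) :
    rename e ((1 + ∑ p : τ, X p : MvPolynomial τ k) ^ D) = (1 + ∑ p : τ, X p : MvPolynomial τ k) ^ D := by
  simp only [map_pow, map_add, map_one, map_sum, rename_X]
  rw [e.sum_comp (fun p => (X p : MvPolynomial τ k))]

/-! ### Lifting nonnegative real polynomials to `ℝ≥0` -/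

/-- A real polynomial all of whose coefficients are nonnegative is the image of a polynomial over
`ℝ≥0`. [folklore] -/
theorem exists_nnreal_of_coeff_nonneg {τ : Type*} (q : MvPolynomial τ ℝ) (hq : ∀ m, 0 ≤ coeff m q) :
    ∃ h : MvPolynomial τ NNReal, map NNReal.toRealHom h = q := by
  classical
  refine ⟨∑ m ∈ q.support, monomial m ⟨coeff m q, hq m⟩, ?_⟩
  rw [map_sum]
  simp only [map_monomial]
  conv_rhs => rw [q.as_sum]
  rfl

end Summit.ValiantsHypothesis.ValiantsHypothesis.Theorems
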